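import Summits.AtomisticToContinuum.HydrodynamicLimit.Theses.BoxDissipativeWeakStrong
import Summits.AtomisticToContinuum.HydrodynamicLimit.Theorems.BoxDissipativeWeakStrongDefs
import Summits.AtomisticToContinuum.HydrodynamicLimit.Theorems.BoxDissipativeWeakStrongLocalGibbsFineScaleStaticsPrelim
import Summits.AtomisticToContinuum.HydrodynamicLimit.Theorems.JParityClosureKineticEnergyTailsApriori
import Literature.Analysis.FluidPDE.HardSphereFlowJointMeasurable
import Literature.MathematicalPhysics.KineticTheory.HardSphereBBGKYLiouvilleFlow

/-!
# Crux `EntropyAdmissibility` (stmt-AtomisticToContinuum-9903), line `registered` — stub `stub_dynPartIntegrable`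

Registered stub S1a of the line `registered` of the crux
`Summit.AtomisticToContinuum.HydrodynamicLimit.Theses.BoxDissipativeWeakStrong.EntropyAdmissibility`: in the
crux's quantifier frame, for every `N` the DYNAMIC part `A_N = BDWS.dynPart … N` of the clamp-renormalised entropy
balance of the hard-sphere box fields, `∫_{(0,τ]}∫(ρ̂ Z_{a,b}(ŝ) ∂ₜφ + Z_{a,b}(ŝ) m̂·∇φ) dx dt − ∫ ρ̂_τ Z_{a,b}(ŝ_τ) φ_τ dx`,
is integrable under the local Gibbs law `P_N = localGibbsLaw σ a₀ u₀ θ₀ N (Φ N)`. Proof (measure theory only):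
* the integrands are STATIC functionals of the configuration `w = Φ_t z` (`statEntropy`, `statBulk`, `statBdry`;
  `dynPart = ∫∫ statBulk ∘ Φ_t − ∫ statBdry ∘ Φ_τ` definitionally), jointly measurable in `(t, w, x)`: the box
  fields by `LGFS.measurable_empirical*Field_param`; the clamped cut entropy because the `limsup`-defined excess
  free energy is only evaluated in `[0, η₁] ⊆ [0, η₀)` where it is continuous (`HsEosLowDensity`, `ηc := η₀`);
  the test data `∂ₜφ, ∇φ` after CLAMPING time to `[0, τ]` — invisible on `(0, τ]` (`dynPart_eq_clamp`), the
  clamped space–time lift being globally continuous (`measurable_clampTime`);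
* a.e.-strong measurability of `A_N`: joint measurability of the flow on its conull good set
  (`HardSphereFlow.measurable_flow_prod_torus`), `StronglyMeasurable.integral_prod_right'` twice, `P_N ≪ Liouville`;
* domination `|A_N(z)| ≤ A + B · configEnergy z` on the good set (`|ρ̂| ≤ ℓ⁻³`, `‖m̂‖ ≤ ℓ⁻³ (1 + 2E(w))`,
  `|Z_{a,b}| ≤ |a| ∨ |b|`, sup bounds of `∂ₜφ, ∇φ, φ` on `[0, τ] × 𝕋³`, `HardSphereFlow.configEnergy_flow`), and
  `E_{P_N}[configEnergy] < ∞` (Gaussian velocities, `lintegral_meanVelObs_localGibbsMeasure_le`); `σ₀ := 1/2`.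

References: J. Březina, E. Feireisl, J. Math. Soc. Japan 70 (2018), Def. 2.9, §3.2; H. Spohn, *Large Scale
Dynamics of Interacting Particles* (1991), Part I Ch. 3. prover-line-stmt-AtomisticToContinuum-9903-0.
-/

noncomputable section

open MeasureTheory Filter Set
open scoped ENNReal Topology

namespace Summit.AtomisticToContinuum.HydrodynamicLimit.Theorems.EABirthS1a

open Literature.MathematicalPhysics.KineticTheory
open Literature.Analysis.FluidPDE.CompressibleEuler (clamp)
open Summit.AtomisticToContinuum.HydrodynamicLimit.Theses
open Summit.AtomisticToContinuum.HydrodynamicLimit.Theorems.BDWS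
open Literature.Analysis.FluidPDE (Config configEnergy HardSphereFlow)
open Literature.Analysis.FunctionSpaces

/-- A function continuous on a set, composed with a measurable map INTO that set, is measurable. -/
theorem measurable_comp_of_continuousOn {α β γ : Type*} [MeasurableSpace α] [TopologicalSpace β]
    [MeasurableSpace β] [OpensMeasurableSpace β] [TopologicalSpace γ] [MeasurableSpace γ] [BorelSpace γ]
    {f : β → γ} {s : Set β} (hf : ContinuousOn f s) {g : α → β} (hg : Measurable g)
    (hgs : ∀ x, g x ∈ s) : Measurable fun x => f (g x) := by
  have h1 : Measurable fun x => (⟨g x, hgs x⟩ : s) := hg.subtype_mk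
  exact (continuousOn_iff_continuous_restrict.1 hf).measurable.comp h1

/-- **Time clamp.** A space–time field whose lift is continuous on `S × ℝ³` becomes jointly measurable on
`ℝ × 𝕋³` after clamping time to a compact interval `[a, b] ⊆ S`. -/
theorem measurable_clampTime {G : Type*} [NormedAddCommGroup G] [MeasurableSpace G] [BorelSpace G]
    {S : Set ℝ} {u : ℝ → T3 → G} (hu : ContinuousOn (Torus.stLift u) (S ×ˢ univ)) {a b : ℝ}
    (hab : a ≤ b) (hS : Icc a b ⊆ S) : Measurable fun q : ℝ × T3 => u (max a (min q.1 b)) q.2 := by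
  have hm : Measurable fun q : ℝ × T3 => ((max a (min q.1 b), Torus.repr q.2) : ℝ × EuclideanSpace ℝ (Fin 3)) :=
    (measurable_const.max (measurable_fst.min measurable_const)).prodMk
      (Torus.measurable_repr.comp measurable_snd)
  have h := measurable_comp_of_continuousOn hu hm fun q =>
    mk_mem_prod (hS ⟨le_max_left _ _, max_le hab (min_le_right _ _)⟩) (mem_univ _)
  simpa only [Torus.stLift_apply, Torus.proj_repr] using h

variable {N : ℕ}

/-- Static clamped box entropy `G(w, x) = Z_{a,b}(s_cut(ρ̂, θ̂(ρ̂, m̂, Ê)))`, the empirical fields of the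
configuration `w` being tested against the box kernel `K_l(x, ·)`
(so that `boxClampedEntropy σ η₁ ℓ Φ a b N t z x = statEntropy σ η₁ (ℓ N) a b (Φ_t z) x` definitionally). -/
def statEntropy (σ η₁ l a b : ℝ) (w : Config (N + 1) (Fin 3) T3) (x : T3) : ℝ :=
  clamp a b (cutEntropy σ η₁ (empiricalDensityField w (boxKernel l x))
    (boxTemp (empiricalDensityField w (boxKernel l x)) (empiricalMomentumField w (boxKernel l x))
      (empiricalEnergyField w (boxKernel l x))))

/-- Static bulk integrand `ρ̂ G ψ₁(t,x) + G m̂·ψ₂(t,x)` (test data `ψ₁`, `ψ₂`). -/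
def statBulk (σ η₁ l a b : ℝ) (ψ₁ : ℝ → T3 → ℝ) (ψ₂ : ℝ → T3 → V3) (t : ℝ)
    (w : Config (N + 1) (Fin 3) T3) (x : T3) : ℝ :=
  empiricalDensityField w (boxKernel l x) * statEntropy σ η₁ l a b w x * ψ₁ t x +
    statEntropy σ η₁ l a b w x * inner ℝ (empiricalMomentumField w (boxKernel l x)) (ψ₂ t x)

/-- Static boundary integrand `ρ̂ G χ(x)` (test slice `χ`). -/
def statBdry (σ η₁ l a b : ℝ) (χ : T3 → ℝ) (w : Config (N + 1) (Fin 3) T3) (x : T3) : ℝ :=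
  empiricalDensityField w (boxKernel l x) * statEntropy σ η₁ l a b w x * χ x

/-- `dynPart` is the time–space integral of `statBulk` along the flow minus the space integral of `statBdry`
at time `τ`, with the test data `∂ₜφ`, `∇φ` CLAMPED in time to `[0, τ]` (definitional unfolding, plus the fact
that the clamp is the identity on `(0, τ]`). -/
theorem dynPart_eq_clamp (σ η₁ T : ℝ) (ℓ : ℕ → ℝ) (Φ : FlowFamily σ) (τ a b : ℝ) (φ : ℝ → T3 → ℝ)
    (N : ℕ) (z : Config (N + 1) (Fin 3) T3) :
    dynPart σ η₁ T ℓ Φ τ a b φ N z =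
      (∫ t in Ioc 0 τ, ∫ x, statBulk σ η₁ (ℓ N) a b
          (fun s => Torus.timeDerivWithin (Ico 0 T) φ (max 0 (min s τ)))
          (fun s => Torus.gradient (φ (max 0 (min s τ)))) t ((Φ N).flow t z) x) -
        ∫ x, statBdry σ η₁ (ℓ N) a b (φ τ) ((Φ N).flow τ z) x := by
  show (∫ t in Ioc 0 τ, ∫ x, statBulk σ η₁ (ℓ N) a b (Torus.timeDerivWithin (Ico 0 T) φ)
      (fun s => Torus.gradient (φ s)) t ((Φ N).flow t z) x) - _ = _
  congr 1
  refine setIntegral_congr_fun measurableSet_Ioc fun t ht => ?_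
  simp only [statBulk, min_eq_left ht.2, max_eq_right ht.1.le]

/-- The clamped cut entropy of the box fields is jointly measurable in `(w, x)`, provided the excess free
energy is continuous on `[0, η₀)` and `0 ≤ η₁ < η₀` (it is only evaluated on `[0, η₁]`, as `ρ̂ ≥ 0`). -/
theorem measurable_statEntropy {η₀ : ℝ} (hcont : ContinuousOn hsExcessFreeEnergy (Ico 0 η₀))
    {σ η₁ l : ℝ} (hσ : 0 ≤ σ) (hη₁ : 0 ≤ η₁) (hη₁c : η₁ < η₀) (hl : 0 ≤ l) (a b : ℝ) :
    Measurable fun q : Config (N + 1) (Fin 3) T3 × T3 => statEntropy σ η₁ l a b q.1 q.2 := by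
  have hR : Measurable fun q : Config (N + 1) (Fin 3) T3 × T3 => empiricalDensityField q.1 (boxKernel l q.2) :=
    LGFS.measurable_empiricalDensityField_param (k := boxKernel l) (LGFS.measurable_boxK_uncurry l)
  have hM : Measurable fun q : Config (N + 1) (Fin 3) T3 × T3 => empiricalMomentumField q.1 (boxKernel l q.2) :=
    LGFS.measurable_empiricalMomentumField_param (k := boxKernel l) (LGFS.measurable_boxK_uncurry l)
  have hE : Measurable fun q : Config (N + 1) (Fin 3) T3 × T3 => empiricalEnergyField q.1 (boxKernel l q.2) :=
    LGFS.measurable_empiricalEnergyField_param (k := boxKernel l) (LGFS.measurable_boxK_uncurry l)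
  have hF : Measurable fun q : Config (N + 1) (Fin 3) T3 × T3 =>
      hsExcessFreeEnergy (min (empiricalDensityField q.1 (boxKernel l q.2) * σ ^ 3) η₁) := by
    refine measurable_comp_of_continuousOn hcont ((hR.mul_const _).min measurable_const) fun q => ?_
    have h0 : 0 ≤ empiricalDensityField q.1 (boxKernel l q.2) := by
      rw [empiricalDensityField_eq_sum]
      exact LGFS.avg_nonneg (g := boxKernel l q.2) (LGFS.boxK_nonneg hl q.2) _
    exact ⟨le_min (mul_nonneg h0 (pow_nonneg hσ 3)) hη₁, (min_le_right _ _).trans_lt hη₁c⟩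
  have hθ : Measurable fun q : Config (N + 1) (Fin 3) T3 × T3 =>
      boxTemp (empiricalDensityField q.1 (boxKernel l q.2)) (empiricalMomentumField q.1 (boxKernel l q.2))
        (empiricalEnergyField q.1 (boxKernel l q.2)) := by
    unfold boxTemp
    exact measurable_const.mul ((hE.div hR).sub ((hM.norm.pow_const 2).div (measurable_const.mul (hR.pow_const 2))))
  unfold statEntropy cutEntropy cutExcessFreeEnergy
  exact (Literature.Analysis.FluidPDE.CompressibleEuler.continuous_clamp a b).measurable.comp
    (((measurable_const.mul (Real.measurable_log.comp hθ)).sub (Real.measurable_log.comp hR)).sub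
      (hF.add (measurable_const.mul (Real.measurable_log.comp
        (((hR.mul_const _).max measurable_const).div_const _)))))

/-- The bulk integrand is jointly measurable in `(t, w, x)` for jointly measurable test data. -/
theorem measurable_statBulk {σ η₁ l a b : ℝ}
    (hG : Measurable fun q : Config (N + 1) (Fin 3) T3 × T3 => statEntropy σ η₁ l a b q.1 q.2)
    {ψ₁ : ℝ → T3 → ℝ} {ψ₂ : ℝ → T3 → V3} (hψ₁ : Measurable fun q : ℝ × T3 => ψ₁ q.1 q.2)
    (hψ₂ : Measurable fun q : ℝ × T3 => ψ₂ q.1 q.2) :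
    Measurable fun q : (ℝ × Config (N + 1) (Fin 3) T3) × T3 => statBulk σ η₁ l a b ψ₁ ψ₂ q.1.1 q.1.2 q.2 := by
  have hwx : Measurable fun q : (ℝ × Config (N + 1) (Fin 3) T3) × T3 => (q.1.2, q.2) :=
    (measurable_snd.comp measurable_fst).prodMk measurable_snd
  have htx : Measurable fun q : (ℝ × Config (N + 1) (Fin 3) T3) × T3 => (q.1.1, q.2) :=
    (measurable_fst.comp measurable_fst).prodMk measurable_snd
  have hR := (LGFS.measurable_empiricalDensityField_param (n := N + 1) (k := boxKernel l) (LGFS.measurable_boxK_uncurry l)).comp hwx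
  have hM := (LGFS.measurable_empiricalMomentumField_param (n := N + 1) (k := boxKernel l) (LGFS.measurable_boxK_uncurry l)).comp hwx
  unfold statBulk
  exact ((hR.mul (hG.comp hwx)).mul (hψ₁.comp htx)).add ((hG.comp hwx).mul (hM.inner (hψ₂.comp htx)))

/-- The boundary integrand is jointly measurable in `(w, x)` for a measurable test slice. -/
theorem measurable_statBdry {σ η₁ l a b : ℝ}
    (hG : Measurable fun q : Config (N + 1) (Fin 3) T3 × T3 => statEntropy σ η₁ l a b q.1 q.2)
    {χ : T3 → ℝ} (hχ : Measurable χ) :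
    Measurable fun q : Config (N + 1) (Fin 3) T3 × T3 => statBdry σ η₁ l a b χ q.1 q.2 := by
  have hR := LGFS.measurable_empiricalDensityField_param (n := N + 1) (k := boxKernel l) (LGFS.measurable_boxK_uncurry l)
  unfold statBdry
  exact (hR.mul hG).mul (hχ.comp measurable_snd)

/-- `|ρ̂| ≤ ℓ⁻³` (an average of kernel values in `[0, ℓ⁻³]`). -/
theorem abs_density_le {l : ℝ} (hl : 0 ≤ l) (w : Config (N + 1) (Fin 3) T3) (x : T3) :
    |empiricalDensityField w (boxKernel l x)| ≤ (l ^ 3)⁻¹ := by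
  rw [empiricalDensityField_eq_sum]
  exact LGFS.abs_avg_le (g := boxKernel l x) (LGFS.boxK_nonneg hl x) (LGFS.boxK_le hl x) fun i => (w i).1

/-- `‖m̂‖ ≤ ℓ⁻³ (1 + 2 E(w))`, `E(w) = ½ Σ ‖vᵢ‖²` (`‖v‖ ≤ 1 + ‖v‖²` termwise, `(N+1)⁻¹ ≤ 1`). -/
theorem norm_momentum_le {l : ℝ} (hl : 0 ≤ l) (w : Config (N + 1) (Fin 3) T3) (x : T3) :
    ‖empiricalMomentumField w (boxKernel l x)‖ ≤ (l ^ 3)⁻¹ * (1 + 2 * configEnergy w) := by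
  have hL : 0 ≤ (l ^ 3)⁻¹ := inv_nonneg.2 (pow_nonneg hl 3)
  have hE0 : 0 ≤ configEnergy w := by unfold configEnergy; positivity
  have hE : ∑ i, ‖(w i).2‖ ^ 2 = 2 * configEnergy w := by simp only [configEnergy]; ring
  have hterm : ∀ i, ‖boxKernel l x (w i).1 • (w i).2‖ ≤ (l ^ 3)⁻¹ * (1 + ‖(w i).2‖ ^ 2) := fun i => by
    rw [norm_smul, Real.norm_eq_abs, abs_of_nonneg (show 0 ≤ boxKernel l x (w i).1 from LGFS.boxK_nonneg hl x _)]
    refine mul_le_mul (LGFS.boxK_le hl x _) ?_ (norm_nonneg _) hL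
    nlinarith [norm_nonneg (w i).2, sq_nonneg (‖(w i).2‖ - 1)]
  have hsum : ‖∑ i, boxKernel l x (w i).1 • (w i).2‖ ≤ (l ^ 3)⁻¹ * (((N : ℝ) + 1) + 2 * configEnergy w) := by
    refine (norm_sum_le _ _).trans ((Finset.sum_le_sum fun i _ => hterm i).trans (le_of_eq ?_))
    rw [← Finset.mul_sum, Finset.sum_add_distrib, Finset.sum_const, Finset.card_univ, Fintype.card_fin, hE]
    ring
  have hn : (0 : ℝ) < ((N + 1 : ℕ) : ℝ) := by positivity
  have hn1 : (((N + 1 : ℕ) : ℝ))⁻¹ ≤ 1 := inv_le_one_of_one_le₀ (by exact_mod_cast Nat.succ_pos N)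
  have hinv : (((N + 1 : ℕ) : ℝ))⁻¹ * ((N : ℝ) + 1) = 1 := by rw [← Nat.cast_add_one, inv_mul_cancel₀ hn.ne']
  rw [empiricalMomentumField_eq_sum, norm_smul, Real.norm_of_nonneg (inv_nonneg.2 hn.le)]
  calc (((N + 1 : ℕ) : ℝ))⁻¹ * ‖∑ i, boxKernel l x (w i).1 • (w i).2‖
      ≤ (((N + 1 : ℕ) : ℝ))⁻¹ * ((l ^ 3)⁻¹ * (((N : ℝ) + 1) + 2 * configEnergy w)) :=
        mul_le_mul_of_nonneg_left hsum (inv_nonneg.2 hn.le)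
    _ ≤ (l ^ 3)⁻¹ * (1 + 2 * configEnergy w) := by
        nlinarith [mul_nonneg (mul_nonneg (sub_nonneg.2 hn1) hL) hE0, hinv]

/-- Bound on the bulk integrand, `|statBulk t w x| ≤ A₀ + B₀ E(w)`, from sup bounds of the test data. -/
theorem exists_abs_statBulk_le {σ η₁ l a b : ℝ} (hab : a ≤ b) (hl : 0 ≤ l) {ψ₁ : ℝ → T3 → ℝ}
    {ψ₂ : ℝ → T3 → V3} {D Gs : ℝ} (hD : ∀ t x, ‖ψ₁ t x‖ ≤ D) (hGs : ∀ t x, ‖ψ₂ t x‖ ≤ Gs) :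
    ∃ A₀ B₀ : ℝ, ∀ (t : ℝ) (w : Config (N + 1) (Fin 3) T3) (x : T3),
      |statBulk σ η₁ l a b ψ₁ ψ₂ t w x| ≤ A₀ + B₀ * configEnergy w := by
  have hM0 : 0 ≤ max |a| |b| := le_max_of_le_left (abs_nonneg a)
  have hL : 0 ≤ (l ^ 3)⁻¹ := inv_nonneg.2 (pow_nonneg hl 3)
  refine ⟨(l ^ 3)⁻¹ * max |a| |b| * D + max |a| |b| * (l ^ 3)⁻¹ * Gs, 2 * max |a| |b| * (l ^ 3)⁻¹ * Gs,
    fun t w x => ?_⟩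
  have hE0 : 0 ≤ configEnergy w := by unfold configEnergy; positivity
  have hGc : |statEntropy σ η₁ l a b w x| ≤ max |a| |b| := Literature.Analysis.FluidPDE.CompressibleEuler.abs_clamp_le hab _
  have h1 : |empiricalDensityField w (boxKernel l x) * statEntropy σ η₁ l a b w x * ψ₁ t x| ≤
      (l ^ 3)⁻¹ * max |a| |b| * D := by
    rw [abs_mul, abs_mul, ← Real.norm_eq_abs (ψ₁ t x)]
    exact mul_le_mul (mul_le_mul (abs_density_le hl w x) hGc (abs_nonneg _) hL) (hD t x) (norm_nonneg _)
      (mul_nonneg hL hM0)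
  have h2 : |statEntropy σ η₁ l a b w x * inner ℝ (empiricalMomentumField w (boxKernel l x)) (ψ₂ t x)| ≤
      max |a| |b| * ((l ^ 3)⁻¹ * (1 + 2 * configEnergy w) * Gs) := by
    rw [abs_mul]
    refine mul_le_mul hGc ?_ (abs_nonneg _) hM0
    exact (abs_real_inner_le_norm _ _).trans
      (mul_le_mul (norm_momentum_le hl w x) (hGs t x) (norm_nonneg _) (mul_nonneg hL (by positivity)))
  calc |statBulk σ η₁ l a b ψ₁ ψ₂ t w x| ≤ _ + _ := abs_add_le _ _
    _ ≤ (l ^ 3)⁻¹ * max |a| |b| * D + max |a| |b| * ((l ^ 3)⁻¹ * (1 + 2 * configEnergy w) * Gs) :=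
        add_le_add h1 h2
    _ = _ := by ring

/-- Bound on the boundary integrand, `|statBdry w x| ≤ ℓ⁻³ (|a| ∨ |b|) C`, given `‖χ x‖ ≤ C`. -/
theorem abs_statBdry_le {σ η₁ l a b : ℝ} (hab : a ≤ b) (hl : 0 ≤ l) {χ : T3 → ℝ} {x : T3} {C : ℝ}
    (hC : ‖χ x‖ ≤ C) (w : Config (N + 1) (Fin 3) T3) :
    |statBdry σ η₁ l a b χ w x| ≤ (l ^ 3)⁻¹ * max |a| |b| * C := by
  have hM0 : 0 ≤ max |a| |b| := le_max_of_le_left (abs_nonneg a)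
  have hL : 0 ≤ (l ^ 3)⁻¹ := inv_nonneg.2 (pow_nonneg hl 3)
  unfold statBdry
  rw [abs_mul, abs_mul, ← Real.norm_eq_abs (χ x)]
  exact mul_le_mul (mul_le_mul (abs_density_le hl w x) (Literature.Analysis.FluidPDE.CompressibleEuler.abs_clamp_le hab _)
    (abs_nonneg _) hL) hC (norm_nonneg _) (mul_nonneg hL hM0)

/-- **Fubini measurability along the flow, two layers.** For a jointly measurable `H(t, w, x)` and an
s-finite time measure `ν`, `z ↦ ∫ (∫ H(t, Φ_t z, x) dx) dν(t)` is strongly measurable on the good set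
(`HardSphereFlow.measurable_flow_prod_torus` and `StronglyMeasurable.integral_prod_right'` twice). -/
theorem stronglyMeasurable_integral_integral_flow {ε : ℝ} {n : ℕ}
    (Φ : HardSphereFlow (Literature.Analysis.FluidPDE.Torus.geometry (Fin 3)) ε n)
    {H : ℝ → Config n (Fin 3) T3 → T3 → ℝ} (hH : Measurable fun q : (ℝ × Config n (Fin 3) T3) × T3 => H q.1.1 q.1.2 q.2)
    (ν : Measure ℝ) [SFinite ν] :
    StronglyMeasurable fun z : Φ.good => ∫ t, (∫ x, H t (Φ.flow t (z : Config n (Fin 3) T3)) x) ∂ν := by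
  have h1 : Measurable fun q : (Φ.good × ℝ) × T3 => H q.1.2 (Φ.flow q.1.2 (q.1.1 : Config n (Fin 3) T3)) q.2 :=
    hH.comp ((((measurable_snd.comp measurable_fst).prodMk
      (Φ.measurable_flow_prod_torus.comp measurable_fst))).prodMk measurable_snd)
  have h2 : StronglyMeasurable fun p : Φ.good × ℝ => ∫ x, H p.2 (Φ.flow p.2 (p.1 : Config n (Fin 3) T3)) x :=
    h1.stronglyMeasurable.integral_prod_right'
  exact h2.integral_prod_right'

/-- **The kinetic energy is integrable under the local Gibbs law**: conditionally on the positions the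
velocities are Gaussian with `∫ |v|² dN(u₀(y), θ₀(y)) = |u₀(y)|² + 3θ₀(y) ≤ U² + 3Θ`
(`lintegral_meanVelObs_localGibbsMeasure_le`). -/
theorem integrable_configEnergy_localGibbsLaw {a₀ θ₀ : T3 → ℝ} {u₀ : T3 → V3} (ha : Continuous a₀)
    (hθ : Continuous θ₀) (hu : Continuous u₀) (ha0 : ∀ x, 0 ≤ a₀ x) (hθ0 : ∀ x, 0 < θ₀ x) (σ : ℝ) (N : ℕ)
    (Φ : HardSphereFlow (Literature.Analysis.FluidPDE.Torus.geometry (Fin 3)) (hsDiameter σ N) (N + 1)) :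
    Integrable (fun z : Config (N + 1) (Fin 3) T3 => configEnergy z) (localGibbsLaw σ a₀ u₀ θ₀ N Φ) := by
  obtain ⟨U, -, hU⟩ := exists_forall_abs_le_of_continuous (χ := fun x => ‖u₀ x‖) hu.norm
  obtain ⟨Θ, -, hΘ⟩ := exists_forall_abs_le_of_continuous hθ
  have hm : Measurable fun z : Config (N + 1) (Fin 3) T3 => ((N : ℝ) + 1)⁻¹ * ∑ i, ‖(z i).2‖ ^ 2 := by fun_prop
  have hmean : Integrable (fun z : Config (N + 1) (Fin 3) T3 => ((N : ℝ) + 1)⁻¹ * ∑ i, ‖(z i).2‖ ^ 2)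
      (localGibbsLaw σ a₀ u₀ θ₀ N Φ) := by
    refine ⟨hm.aestronglyMeasurable, ?_⟩
    rw [hasFiniteIntegral_iff_ofReal (Eventually.of_forall fun z => by simp only [Pi.zero_apply]; positivity)]
    refine lt_of_le_of_lt (b := ENNReal.ofReal (U ^ 2 + 3 * Θ)) ?_ ENNReal.ofReal_lt_top
    rw [localGibbsLaw_eq]
    refine lintegral_meanVelObs_localGibbsMeasure_le ha hθ hu ha0 hθ0 (f := fun v : V3 => ‖v‖ ^ 2)
      (by fun_prop) (fun v => sq_nonneg _) (fun y => ?_) σ N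
    rw [lintegral_norm_sq_gaussMeasure (u₀ y) (hθ0 y)]
    have h1 : ‖u₀ y‖ ≤ U := by simpa only [abs_of_nonneg (norm_nonneg _)] using hU y
    exact ENNReal.ofReal_le_ofReal (by nlinarith [(le_abs_self _).trans (hΘ y), pow_le_pow_left₀ (norm_nonneg _) h1 2])
  have hN : (N : ℝ) + 1 ≠ 0 := by positivity
  refine (hmean.const_mul (((N : ℝ) + 1) / 2)).congr (Eventually.of_forall fun z => ?_)
  simp only [configEnergy]
  field_simp

section DynPart

variable {η₀ η₁ σ T τ a b : ℝ} {ℓ : ℕ → ℝ} {φ : ℝ → T3 → ℝ}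

/-- **`A_N` is a.e.-strongly measurable** for every law carried by the good set of `Φ N`. -/
theorem aestronglyMeasurable_dynPart (hcont : ContinuousOn hsExcessFreeEnergy (Ico 0 η₀)) (hη₁ : 0 < η₁)
    (hη₁c : η₁ < η₀) (hσ : 0 < σ) (Φ : FlowFamily σ) (hℓ : 0 < ℓ N) (hτ : τ ∈ Ico 0 T)
    (hφ : Torus.IsSmoothSpaceTimeOn (Ico 0 T) φ) {P : Measure (Config (N + 1) (Fin 3) T3)}
    (hP : P (Φ N).goodᶜ = 0) : AEStronglyMeasurable (dynPart σ η₁ T ℓ Φ τ a b φ N) P := by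
  have hIcc : Icc 0 τ ⊆ Ico 0 T := fun t ht => ⟨ht.1, ht.2.trans_lt hτ.2⟩
  have hS : UniqueDiffOn ℝ (Ico 0 T) := uniqueDiffOn_Ico 0 T
  have hG := measurable_statEntropy (N := N) hcont hσ.le hη₁.le hη₁c hℓ.le a b
  have hm₁ : Measurable fun q : ℝ × T3 => Torus.timeDerivWithin (Ico 0 T) φ (max 0 (min q.1 τ)) q.2 :=
    measurable_clampTime (hφ.timeDerivWithin hS).continuousOn_stLift hτ.1 hIcc
  have hm₂ : Measurable fun q : ℝ × T3 => Torus.gradient (φ (max 0 (min q.1 τ))) q.2 :=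
    measurable_clampTime (u := fun s => Torus.gradient (φ s)) (hφ.gradient hS).continuousOn_stLift hτ.1 hIcc
  have hmτ : Measurable (φ τ) := (hφ.isSmooth_slice (hIcc ⟨hτ.1, le_rfl⟩)).continuous.measurable
  have key := stronglyMeasurable_integral_integral_flow (Φ N)
    (measurable_statBulk (ψ₁ := fun s => Torus.timeDerivWithin (Ico 0 T) φ (max 0 (min s τ)))
      (ψ₂ := fun s => Torus.gradient (φ (max 0 (min s τ)))) hG hm₁ hm₂) (volume.restrict (Ioc 0 τ))
  have h1 : AEStronglyMeasurable (fun z => ∫ t in Ioc 0 τ, ∫ x, statBulk σ η₁ (ℓ N) a b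
      (fun s => Torus.timeDerivWithin (Ico 0 T) φ (max 0 (min s τ)))
      (fun s => Torus.gradient (φ (max 0 (min s τ)))) t ((Φ N).flow t z) x) P :=
    ((Φ N).aemeasurable_of_measurable_comp_subtype (g := fun z => ∫ t in Ioc 0 τ, ∫ x, statBulk σ η₁ (ℓ N) a b
      (fun s => Torus.timeDerivWithin (Ico 0 T) φ (max 0 (min s τ)))
      (fun s => Torus.gradient (φ (max 0 (min s τ)))) t ((Φ N).flow t z) x) key.measurable hP).aestronglyMeasurable
  have h2 : AEStronglyMeasurable (fun z => ∫ x, statBdry σ η₁ (ℓ N) a b (φ τ) ((Φ N).flow τ z) x) P :=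
    (((measurable_statBdry hG hmτ).comp ((((Φ N).measurable_flow τ).comp measurable_fst).prodMk
      measurable_snd)).stronglyMeasurable (α := Config (N + 1) (Fin 3) T3 × T3)).integral_prod_right'.aestronglyMeasurable
  exact (h1.sub h2).congr (Eventually.of_forall fun z => (dynPart_eq_clamp σ η₁ T ℓ Φ τ a b φ N z).symm)

/-- **Domination on the good set**: `‖A_N(z)‖ ≤ A + B · configEnergy z` for good `z` (sup bounds of the test data
on `[0, τ] × 𝕋³`, `|ρ̂| ≤ ℓ⁻³`, `‖m̂‖ ≤ ℓ⁻³(1 + 2E)`, `|Z_{a,b}| ≤ |a| ∨ |b|`, conservation of energy). -/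
theorem exists_norm_dynPart_le (Φ : FlowFamily σ) (hℓ : 0 < ℓ N) (hτ : τ ∈ Ico 0 T) (hab : a ≤ b)
    (hφ : Torus.IsSmoothSpaceTimeOn (Ico 0 T) φ) (η₁ : ℝ) :
    ∃ A B : ℝ, ∀ z ∈ (Φ N).good, ‖dynPart σ η₁ T ℓ Φ τ a b φ N z‖ ≤ A + B * configEnergy z := by
  have hIcc : Icc 0 τ ⊆ Ico 0 T := fun t ht => ⟨ht.1, ht.2.trans_lt hτ.2⟩
  have hS : UniqueDiffOn ℝ (Ico 0 T) := uniqueDiffOn_Ico 0 T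
  have hcl : ∀ t : ℝ, max 0 (min t τ) ∈ Icc 0 τ := fun t => ⟨le_max_left _ _, max_le hτ.1 (min_le_right _ _)⟩
  obtain ⟨D, hD⟩ := (hφ.timeDerivWithin hS).exists_norm_le_of_isCompact isCompact_Icc hIcc
  obtain ⟨Gs, hGs⟩ := (hφ.gradient hS).exists_norm_le_of_isCompact isCompact_Icc hIcc
  obtain ⟨Pφ, hPφ⟩ := hφ.exists_norm_le_of_isCompact isCompact_Icc hIcc
  obtain ⟨A₀, B₀, hAB⟩ := exists_abs_statBulk_le (N := N) (σ := σ) (η₁ := η₁) hab hℓ.le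
    (ψ₁ := fun s => Torus.timeDerivWithin (Ico 0 T) φ (max 0 (min s τ)))
    (ψ₂ := fun s => Torus.gradient (φ (max 0 (min s τ))))
    (fun t x => hD _ (hcl t) x) (fun t x => hGs _ (hcl t) x)
  refine ⟨A₀ * volume.real (Ioc (0 : ℝ) τ) + ((ℓ N) ^ 3)⁻¹ * max |a| |b| * Pφ, B₀ * volume.real (Ioc (0 : ℝ) τ),
    fun z hz => ?_⟩
  rw [dynPart_eq_clamp]
  refine (norm_sub_le _ _).trans ?_
  have hI₂ : ‖∫ x, statBdry σ η₁ (ℓ N) a b (φ τ) ((Φ N).flow τ z) x‖ ≤ ((ℓ N) ^ 3)⁻¹ * max |a| |b| * Pφ := by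
    have h := norm_integral_le_of_norm_le_const (μ := (volume : Measure T3)) (C := ((ℓ N) ^ 3)⁻¹ * max |a| |b| * Pφ)
      (f := fun x => statBdry σ η₁ (ℓ N) a b (φ τ) ((Φ N).flow τ z) x) (Eventually.of_forall fun x =>
        (show ‖statBdry σ η₁ (ℓ N) a b (φ τ) ((Φ N).flow τ z) x‖ ≤ ((ℓ N) ^ 3)⁻¹ * max |a| |b| * Pφ from by
          rw [Real.norm_eq_abs]; exact abs_statBdry_le hab hℓ.le (hPφ τ ⟨hτ.1, le_rfl⟩ x) _))
    simpa only [probReal_univ, mul_one] using h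
  have hI₁ : ‖∫ t in Ioc 0 τ, ∫ x, statBulk σ η₁ (ℓ N) a b
      (fun s => Torus.timeDerivWithin (Ico 0 T) φ (max 0 (min s τ)))
      (fun s => Torus.gradient (φ (max 0 (min s τ)))) t ((Φ N).flow t z) x‖ ≤
      (A₀ + B₀ * configEnergy z) * volume.real (Ioc (0 : ℝ) τ) := by
    refine norm_setIntegral_le_of_norm_le_const measure_Ioc_lt_top fun t _ => ?_
    rw [← (Φ N).configEnergy_flow hz t]
    have h := norm_integral_le_of_norm_le_const (μ := (volume : Measure T3))
      (C := A₀ + B₀ * configEnergy ((Φ N).flow t z))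
      (f := fun x => statBulk σ η₁ (ℓ N) a b (fun s => Torus.timeDerivWithin (Ico 0 T) φ (max 0 (min s τ)))
        (fun s => Torus.gradient (φ (max 0 (min s τ)))) t ((Φ N).flow t z) x)
      (Eventually.of_forall fun x => (show _ ≤ A₀ + B₀ * configEnergy ((Φ N).flow t z) from by
        rw [Real.norm_eq_abs]; exact hAB t _ x))
    simpa only [probReal_univ, mul_one] using h
  calc _ ≤ (A₀ + B₀ * configEnergy z) * volume.real (Ioc (0 : ℝ) τ) + ((ℓ N) ^ 3)⁻¹ * max |a| |b| * Pφ :=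
        add_le_add hI₁ hI₂
    _ = _ := by ring

/-- **Integrability of the dynamic part** (the analytic content of the stub, hypotheses unbundled). -/
theorem integrable_dynPart (hcont : ContinuousOn hsExcessFreeEnergy (Ico 0 η₀)) (hη₁ : 0 < η₁) (hη₁c : η₁ < η₀)
    {a₀ θ₀ : T3 → ℝ} {u₀ : T3 → V3} (ha : Continuous a₀) (hθ : Continuous θ₀) (hu : Continuous u₀)
    (ha0 : ∀ x, 0 < a₀ x) (hθ0 : ∀ x, 0 < θ₀ x) (hσ : 0 < σ) (hσ2 : σ ≤ 1 / 2) (Φ : FlowFamily σ) (hℓ : 0 < ℓ N)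
    (hτ : τ ∈ Ico 0 T) (hab : a ≤ b) (hφ : Torus.IsSmoothSpaceTimeOn (Ico 0 T) φ) :
    Integrable (dynPart σ η₁ T ℓ Φ τ a b φ N) (localGibbsLaw σ a₀ u₀ θ₀ N (Φ N)) := by
  haveI : IsProbabilityMeasure (localGibbsLaw σ a₀ u₀ θ₀ N (Φ N)) :=
    isProbabilityMeasure_localGibbsLaw ha hθ hu ha0 hθ0 hσ2 N (Φ N)
  have hμ : localGibbsLaw σ a₀ u₀ θ₀ N (Φ N) (Φ N).goodᶜ = 0 := by
    rw [localGibbsLaw_eq]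
    exact localGibbsMeasure_absolutelyContinuous σ a₀ u₀ θ₀ N (Φ N) (Φ N).measure_compl_good
  have hgood : ∀ᵐ z ∂(localGibbsLaw σ a₀ u₀ θ₀ N (Φ N)), z ∈ (Φ N).good := by rw [ae_iff]; exact hμ
  obtain ⟨A, B, hAB⟩ := exists_norm_dynPart_le Φ hℓ hτ hab hφ η₁
  have hEi := integrable_configEnergy_localGibbsLaw ha hθ hu (fun x => (ha0 x).le) hθ0 σ N (Φ N)
  refine Integrable.mono' ((integrable_const A).add (hEi.const_mul B))
    (aestronglyMeasurable_dynPart hcont hη₁ hη₁c hσ Φ hℓ hτ hφ hμ) ?_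
  filter_upwards [hgood] with z hz
  exact hAB z hz

end DynPart

/-! ### The stub -/

/-- **S1a — integrability of the dynamic part** (verbatim the skeleton's `Sig.stub_dynPartIntegrable`): in the crux's
quantifier frame, `A_N = dynPart … N ∈ L¹(P_N)` for every `N`. -/
def Sig.stub_dynPartIntegrable : Prop :=
  BoxDissipativeWeakStrong.HsEosLowDensity →
    ∃ ηc : ℝ, 0 < ηc ∧ ∀ η₁ : ℝ, 0 < η₁ → η₁ < ηc →
      ∀ (a₀ θ₀ : T3 → ℝ) (u₀ : T3 → V3), Continuous a₀ → Continuous θ₀ → Continuous u₀ →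
        (∀ x, 0 < a₀ x) → (∀ x, 0 < θ₀ x) →
        ∃ σ₀ : ℝ, 0 < σ₀ ∧ ∀ σ : ℝ, 0 < σ → σ < σ₀ →
          ∀ (T : ℝ) (ρ θ : ℝ → T3 → ℝ) (u : ℝ → T3 → V3), IsHardSphereEulerSolution σ T ρ u θ →
            (∀ t ∈ Ico 0 T, ∀ x, ρ t x * σ ^ 3 ≤ η₁ / 2) →
            ∀ Φ : FlowFamily σ,
              TendstoHydroFieldsAt (fun N => localGibbsLaw σ a₀ u₀ θ₀ N (Φ N)) Φ ρ u θ 0 →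
              ∀ ℓ : ℕ → ℝ, (∀ N, 0 < ℓ N ∧ ℓ N ≤ 1) → Tendsto ℓ atTop (𝓝 0) →
                Tendsto (fun N : ℕ => ℓ N ^ 3 * ((N : ℝ) + 1)) atTop atTop →
                ∀ τ ∈ Ico 0 T, ∀ a b : ℝ, a < b → ∀ φ : ℝ → T3 → ℝ,
                  Literature.Analysis.FunctionSpaces.Torus.IsSmoothSpaceTimeOn (Ico 0 T) φ →
                  (∀ t ∈ Icc 0 τ, ∀ x, 0 ≤ φ t x) →
                  ∀ N : ℕ, Integrable (dynPart σ η₁ T ℓ Φ τ a b φ N) (localGibbsLaw σ a₀ u₀ θ₀ N (Φ N))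

/-- **Registered stub `stub_dynPartIntegrable` (S1a)** of the line `registered` of the crux
stmt-AtomisticToContinuum-9903: for every `N`, the dynamic part of the clamp-renormalised entropy balance is
integrable under the local Gibbs law. Thresholds: `ηc := η₀` of `HsEosLowDensity` (so that `f_ex` is continuous
on `[0, η₁] ⊆ [0, η₀)`), `σ₀ := 1/2` (so that `P_N` is a probability measure). -/
theorem stub_dynPartIntegrable : Sig.stub_dynPartIntegrable := by
  intro hEos
  obtain ⟨η₀, hη₀, F, hFan, hFeq, -⟩ := hEos
  have hcont : ContinuousOn hsExcessFreeEnergy (Ico 0 η₀) :=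
    (hFan.continuousOn.mono fun η hη => ⟨(neg_lt_zero.2 hη₀).trans_le hη.1, hη.2⟩).congr hFeq
  refine ⟨η₀, hη₀, fun η₁ hη₁ hη₁c a₀ θ₀ u₀ ha hθ hu ha0 hθ0 => ⟨1 / 2, one_half_pos, ?_⟩⟩
  intro σ hσ hσ2 T ρ θ u _ _ Φ _ ℓ hℓ _ _ τ hτ a b hab φ hφ _ N
  exact integrable_dynPart hcont hη₁ hη₁c ha hθ hu ha0 hθ0 hσ hσ2.le Φ (hℓ N).1 hτ hab.le hφ

end Summit.AtomisticToContinuum.HydrodynamicLimit.Theorems.EABirthS1a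

end
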